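import Summits.CriticalPhenomena.PercolationContinuityZ3.Theorems.Transplant.SkelPhiWinChainFacts
import Summits.CriticalPhenomena.PercolationContinuityZ3.Theorems.Transplant.SkelPhiWinChainFF
import HarnessLib

/-!
# N2 (frames-only node), (S0) kit tier, (F) spine part 1 (hp-8 g39): **CHAIN FACTS OVER (S0)-SHAPE KITS, APPENDABLE** — the F-twin of
# `SkelPhiWinChainFacts` (hp-8 g33): the ℕ-indexed facts of a linked step family with `kits : KitsAtF` (p1-g16's bundle `TStep.KitsAtF`,
# KNLevelsKitsForced), produced by ONE schedule-frame segment through p1-g16's assembler `kitsAt_stepAFF` (SkelPhiWinChainFF), closed under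
# APPENDING along a cross link, and consumed ONCE by the chain property over `KitsAtF` steps (threshold shape = `lt_real_of_chainFF`'s
# `hchain`; additive shape = `le_real_of_chainFF`'s `hC`, i.e. `KNLevels.chain_edge_additive_F_KN`)

builds on p205010 (kernel theorem, internal audit signed; external expert review pending) — nothing in this file uses p205010; nothing here is a
claim about the open node `SamePDropOfSkeletonFrm₁`.
Lane `prim-bschramm`, seat `prim-hp-8` (gen 39); helper file (`--supports stmt-CriticalPhenomena-4575 --as helper`); F-PORT-JUNCTIONS (hp-8 g37).
Port rule ((S0), p1-g16 2026-08-22 19:19:25Z): `KitsAt ↦ KitsAtF` in the `kits` field and in every chain hypothesis; the per-level `hkits` package is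
`kitsAt_stepAFF`'s (`SHyp ∧ σ.N ≤ P.N ∧ (1 − p^{sB})^k ≤ δ ∧ Sz ⊆ D ∧ faces ⊆ Sz ∧ RelayClause …`); nothing else touched.  `ChainFacts.toF`
records that N1 chain facts are (S0) chain facts (`TStep.KitsAt.toF`).
* §1 `Skelφ.ChainFactsF` (structure, Prop), `ChainFacts.toF`, `chainFactsF_seg` (one segment), `ChainFactsF.append`;
* §2 **`ChainFactsF.lt_real`**, **`ChainFactsF.lt_real_linkIn`** (route-law form under `Skel.routeW`), **`ChainFactsF.le_real`** (additive form).
[cite: KozmaNitzan2024, §4 Lemma 11 (pp. 22–23), Lemma 12 (pp. 23–25), p. 20 (Step IV), p. 24 (P(o ↔^A ·))] [this work]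
-/

noncomputable section

open MeasureTheory ProbabilityTheory
open scoped ENNReal

namespace Summit.CriticalPhenomena.PercolationContinuityZ3.Theorems.Transplant

namespace Skelφ

open Literature.Probability.Percolation Literature.Probability.LatticeModels SimpleGraph
open Literature.Probability.Percolation.KozmaNitzan
open KNLevels ChainPlanar

variable {V : Type} [DecidableEq V] {G' : SimpleGraph V} [G'.LocallyFinite]

/-! ## §1 Chain facts over (S0)-shape kits: one segment, appending -/

/-- **The ℕ-indexed facts of a linked step family of length `n + 1` over (S0)-shape kits** with source `o`, true targets `T'`, under the weighting
`W'`: constant source, links, `T' ⊆ T`, `KitsAtF` at every step, rim excess `≤ η`. [cite: KozmaNitzan2024, §4 Lemma 12 (pp. 23–25)] [this work] -/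
structure ChainFactsF (W' : Sym2 V → unitInterval) (p : unitInterval) (Δ' : ℕ) (δ η : ℝ) (o : V) (s : ℕ → TStep G') (T' : ℕ → Finset V)
    (n : ℕ) : Prop where
  /-- constant source -/
  src : ∀ k ≤ n, (s k).L.o = o
  /-- the true target of step `k` lies in the first level of step `k + 1` -/
  link : ∀ k, k + 1 ≤ n → T' k ⊆ (s (k + 1)).L.X 0
  /-- true targets are targets -/
  sub : ∀ k ≤ n, T' k ⊆ (s k).T
  /-- (S0)-shape kits at every step -/
  kits : ∀ k ≤ n, (s k).KitsAtF W' p Δ' δ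
  /-- the rim excess -/
  exc : ∀ k ≤ n, (prodBernoulli W').real (⋃ t ∈ (s k).T \ T' k, openConn o t) ≤ η

/-- **N1 chain facts are (S0) chain facts** (`δ ≥ 0`), by p1-g16's bridge `TStep.KitsAt.toF`. [this work] -/
theorem ChainFacts.toF {W' : Sym2 V → unitInterval} {p : unitInterval} {Δ' : ℕ} {δ η : ℝ} {o : V} {s : ℕ → TStep G'}
    {T' : ℕ → Finset V} {n : ℕ} (hF : ChainFacts W' p Δ' δ η o s T' n) (hδ : 0 ≤ δ) : ChainFactsF W' p Δ' δ η o s T' n where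
  src := hF.src
  link := hF.link
  sub := hF.sub
  kits k hk := (hF.kits k hk).toF hδ
  exc := hF.exc

namespace WinChainData

variable (P : WinChainData V) (𝒲 : PlanarWindow G') (S : SchedFrame)

/-- **ONE SEGMENT**: the steps `stepAF` / true targets `coreTF` of a schedule frame read through a planar window satisfy the (S0) chain facts,
from the hypotheses of `kitsAt_stepAFF` at every step (per-level FORCED-kit clauses) and the rim excess.
[cite: KozmaNitzan2024, §4 Lemma 11 (pp. 22–23), Lemma 12] [this work] -/
theorem chainFactsF_seg (hRl : P.Rlev + 1 ≤ S.R') (hRim : ∀ k, P.Rim k ⊆ 𝒲.stepDF S k) (hTne : ∀ k ≤ S.N, (𝒲.coreTF S k).Nonempty)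
    {p : unitInterval} {W' : Sym2 V → unitInterval} {Δ' : ℕ} {δ η : ℝ}
    (hsub : ∀ k ≤ S.N, IsSubbox G' W' p (𝒲.stepDF S k)) (hfin : FinSupp W' P.Sfin) (hDS : ∀ k ≤ S.N, 𝒲.stepDF S k ⊆ P.Sfin)
    (ho : ∀ k ≤ S.N, P.o ∉ 𝒲.stepDF S k) (hoS : P.o ∈ P.Sfin) (hj : P.j₁ ≤ P.Rlev)
    (hcount : 1 / (1 - (p : ℝ)) ^ (Δ' * P.N) ≤ δ * ((Finset.Icc P.j₀ P.j₁).card : ℝ))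
    (hkits : ∀ k ≤ S.N, ∀ j ∈ Finset.Icc P.j₀ P.j₁, ∃ (σ : SData V) (Sz : Finset V),
      SHyp (P.stepLF 𝒲 S k) j σ ∧ σ.N ≤ P.N ∧ (1 - (p : ℝ) ^ σ.sB) ^ σ.k ≤ δ ∧ Sz ⊆ 𝒲.stepDF S k ∧ (∀ x ∈ σ.K, σ.face x ⊆ Sz) ∧
      RelayClause (P.stepLF 𝒲 S k) W' j σ Sz (P.coreEF 𝒲 S k) (𝒲.stepDF S k) δ)
    (hexc : ∀ k ≤ S.N, (prodBernoulli W').real (⋃ t ∈ P.Rim k, openConn P.o t) ≤ η) :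
    ChainFactsF W' p Δ' δ η P.o (fun k => P.stepAF 𝒲 S k) (fun k => 𝒲.coreTF S k) S.N where
  src k _ := P.stepAF_o 𝒲 S k
  link k _ := P.coreTF_subset_X_zero_succ 𝒲 S k
  sub k _ := P.coreTF_subset_coreEF 𝒲 S k
  kits k hk := P.kitsAt_stepAFF 𝒲 S hRl hRim hk (hTne k hk) (hsub k hk) hfin (hDS k hk) (ho k hk) hoS hj hcount (hkits k hk)
  exc k hk := by
    refine le_trans (measureReal_mono ?_ (measure_ne_top _ _)) (hexc k hk)
    intro ω hω
    simp only [Set.mem_iUnion, exists_prop] at hω ⊢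
    obtain ⟨t, ht, hωt⟩ := hω
    exact ⟨t, P.coreEF_sdiff_subset 𝒲 S k ht, hωt⟩

end WinChainData

namespace ChainFactsF

variable {W' : Sym2 V → unitInterval} {p : unitInterval} {Δ' : ℕ} {δ η : ℝ} {o : V}

/-- **APPENDING**: two families with the (S0) chain facts and the same source, glued by the cross link `T'₁ n₁ ⊆ X^{(0)}_0` of the second, give
the (S0) chain facts for the piecewise family `pw n₁ s₁ s₂` of length `n₁ + 1 + n₂ + 1`. [cite: KozmaNitzan2024, §4 Lemma 12 (pp. 23–25)] -/
theorem append {s₁ s₂ : ℕ → TStep G'} {T₁ T₂ : ℕ → Finset V} {n₁ n₂ : ℕ} (h₁ : ChainFactsF W' p Δ' δ η o s₁ T₁ n₁)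
    (h₂ : ChainFactsF W' p Δ' δ η o s₂ T₂ n₂) (hx : T₁ n₁ ⊆ (s₂ 0).L.X 0) :
    ChainFactsF W' p Δ' δ η o (pw n₁ s₁ s₂) (pw n₁ T₁ T₂) (n₁ + 1 + n₂) where
  src k hk := by
    by_cases h : k ≤ n₁
    · rw [pw_of_le _ _ h]; exact h₁.src k h
    · rw [pw_of_not_le _ _ h]; exact h₂.src _ (by omega)
  link k hk := by
    by_cases h : k + 1 ≤ n₁
    · rw [pw_of_le _ _ (by omega), pw_of_le _ _ h]; exact h₁.link k h
    · by_cases h' : k = n₁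
      · subst h'
        rw [pw_of_le _ _ le_rfl, show k + 1 = k + 1 + 0 by omega, pw_add]; exact hx
      · obtain ⟨j, rfl⟩ : ∃ j, k = n₁ + 1 + j := ⟨k - (n₁ + 1), by omega⟩
        rw [pw_add, show n₁ + 1 + j + 1 = n₁ + 1 + (j + 1) by omega, pw_add]
        exact h₂.link j (by omega)
  sub k hk := by
    by_cases h : k ≤ n₁
    · rw [pw_of_le _ _ h, pw_of_le _ _ h]; exact h₁.sub k h
    · obtain ⟨j, rfl⟩ : ∃ j, k = n₁ + 1 + j := ⟨k - (n₁ + 1), by omega⟩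
      rw [pw_add, pw_add]; exact h₂.sub j (by omega)
  kits k hk := by
    by_cases h : k ≤ n₁
    · rw [pw_of_le _ _ h]; exact h₁.kits k h
    · obtain ⟨j, rfl⟩ : ∃ j, k = n₁ + 1 + j := ⟨k - (n₁ + 1), by omega⟩
      rw [pw_add]; exact h₂.kits j (by omega)
  exc k hk := by
    by_cases h : k ≤ n₁
    · rw [pw_of_le _ _ h, pw_of_le _ _ h]; exact h₁.exc k h
    · obtain ⟨j, rfl⟩ : ∃ j, k = n₁ + 1 + j := ⟨k - (n₁ + 1), by omega⟩
      rw [pw_add, pw_add]; exact h₂.exc j (by omega)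

/-! ## §2 Applying the chain property over (S0)-shape kits -/

/-- **THE CHAIN PROPERTY (THRESHOLD SHAPE) APPLIED TO (S0) CHAIN FACTS**: the facts of length `n + 1`, the chain property at `(δ ↦ ε)` quantified
over steps with `KitsAtF` (`lt_real_of_chainFF`'s `hchain`), a source bound on a part `B₀` of the first level, the last true target inside `Ft` with
`P_{W'}(⋃_{t ∈ Ft} o ↔ t) ≤ μA` ⟹ `1 − ε < μA`. [cite: KozmaNitzan2024, §4 Lemma 11 (pp. 22–23), Lemma 12 (pp. 23–25), p. 20 (Step IV)] -/
theorem lt_real {s : ℕ → TStep G'} {T' : ℕ → Finset V} {n : ℕ} (hF : ChainFactsF W' p Δ' δ η o s T' n) {ε : ℝ} {B₀ Ft : Finset V}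
    {μA : ℝ}
    (hchain : ∀ (W : Sym2 V → unitInterval) (s : Fin (n + 1) → TStep G') (T' : Fin (n + 1) → Finset V) (η : ℝ),
      (∀ i, (s i).L.o = (s 0).L.o) →
      (∀ i : Fin n, T' (Fin.castSucc i) ⊆ (s i.succ).L.X 0) →
      (∀ i, T' i ⊆ (s i).T) →
      (∀ i, (s i).KitsAtF W p Δ' δ) →
      η ≤ δ / 2 →
      (∀ i, (prodBernoulli W).real (⋃ t ∈ (s i).T \ T' i, openConn (s 0).L.o t) ≤ η) →
      1 - δ < (prodBernoulli W).real (s 0).L.reachB →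
        1 - ε < (prodBernoulli W).real (⋃ t ∈ T' (Fin.last n), openConn (s 0).L.o t))
    (hη : η ≤ δ / 2) (hB₀ : B₀ ⊆ (s 0).L.X 0) (hsrc : 1 - δ < (prodBernoulli W').real (⋃ t ∈ B₀, openConn o t))
    (hTn : T' n ⊆ Ft) (hdom : (prodBernoulli W').real (⋃ t ∈ Ft, openConn o t) ≤ μA) :
    1 - ε < μA := by
  have hle : ∀ i : Fin (n + 1), (i : ℕ) ≤ n := fun i => Nat.lt_succ_iff.1 i.2
  let sF : Fin (n + 1) → TStep G' := fun i => s i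
  let TF : Fin (n + 1) → Finset V := fun i => T' i
  have ho0 : (sF 0).L.o = o := hF.src ((0 : Fin (n + 1)) : ℕ) (hle 0)
  have ho' : ∀ i : Fin (n + 1), (sF i).L.o = (sF 0).L.o := fun i => by rw [ho0]; exact hF.src i (hle i)
  have hlink : ∀ i : Fin n, TF (Fin.castSucc i) ⊆ (sF i.succ).L.X 0 := fun i => by
    show T' (Fin.castSucc i) ⊆ (s (i.succ : ℕ)).L.X 0
    have e : ((i.succ : Fin (n + 1)) : ℕ) = (Fin.castSucc i : ℕ) + 1 := by simp
    rw [e]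
    exact hF.link _ (by have := i.2; simp only [Fin.val_castSucc]; omega)
  have hexc' : ∀ i : Fin (n + 1), (prodBernoulli W').real (⋃ t ∈ (sF i).T \ TF i, openConn (sF 0).L.o t) ≤ η := fun i => by
    rw [ho0]; exact hF.exc i (hle i)
  have hsrc' : 1 - δ < (prodBernoulli W').real (sF 0).L.reachB := by
    refine hsrc.trans_le (measureReal_mono ?_ (measure_ne_top _ _))
    intro ω hω
    simp only [Set.mem_iUnion, exists_prop] at hω
    obtain ⟨t, ht, hωt⟩ := hω
    show ω ∈ ⋃ b ∈ (s ((0 : Fin (n + 1)) : ℕ)).L.X 0, openConn (s ((0 : Fin (n + 1)) : ℕ)).L.o b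
    rw [Fin.val_zero, hF.src 0 (Nat.zero_le _)]
    exact Set.mem_biUnion (Finset.mem_coe.2 (hB₀ ht)) hωt
  have hc := hchain W' sF TF η ho' hlink (fun i => hF.sub i (hle i)) (fun i => hF.kits i (hle i)) hη hexc' hsrc'
  rw [ho0] at hc
  refine hc.trans_le (le_trans (measureReal_mono (fun ω hω => ?_) (measure_ne_top _ _)) hdom)
  simp only [Set.mem_iUnion, exists_prop] at hω ⊢
  obtain ⟨t, ht, hωt⟩ := hω
  refine ⟨t, hTn ?_, hωt⟩
  have e : TF (Fin.last n) = T' n := by show T' ((Fin.last n : Fin (n + 1)) : ℕ) = T' n; rw [Fin.val_last]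
  rw [← e]; exact ht

/-- **ROUTE-LAW FORM**: under `W' := Skel.routeW G Wt Qt S` (`o ∈ S ⊆ Qt`, `S ∩ Ft = ∅`) the same gives `1 − ε < P_{Wt}(linkIn Qt S Ft)`.
[cite: KozmaNitzan2024, §4 Lemma 11 (p. 22), p. 24 (P(o ↔^A ·)), p. 20 (Step IV)] -/
theorem lt_real_linkIn [Countable V] (G : SimpleGraph V) [G.LocallyFinite] {Wt : Sym2 V → unitInterval} {Qt Sd : Finset V}
    {s : ℕ → TStep G'} {T' : ℕ → Finset V} {n : ℕ} (hF : ChainFactsF (Skel.routeW G Wt Qt Sd) p Δ' δ η o s T' n) {ε : ℝ}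
    {B₀ Ft : Finset V}
    (hchain : ∀ (W : Sym2 V → unitInterval) (s : Fin (n + 1) → TStep G') (T' : Fin (n + 1) → Finset V) (η : ℝ),
      (∀ i, (s i).L.o = (s 0).L.o) →
      (∀ i : Fin n, T' (Fin.castSucc i) ⊆ (s i.succ).L.X 0) →
      (∀ i, T' i ⊆ (s i).T) →
      (∀ i, (s i).KitsAtF W p Δ' δ) →
      η ≤ δ / 2 →
      (∀ i, (prodBernoulli W).real (⋃ t ∈ (s i).T \ T' i, openConn (s 0).L.o t) ≤ η) →
      1 - δ < (prodBernoulli W).real (s 0).L.reachB →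
        1 - ε < (prodBernoulli W).real (⋃ t ∈ T' (Fin.last n), openConn (s 0).L.o t))
    (hη : η ≤ δ / 2) (hB₀ : B₀ ⊆ (s 0).L.X 0) (hsrc : 1 - δ < (prodBernoulli (Skel.routeW G Wt Qt Sd)).real (⋃ t ∈ B₀, openConn o t))
    (hTn : T' n ⊆ Ft) (hSQ : Sd ⊆ Qt) (hSF : Disjoint Sd Ft) (hoS : o ∈ Sd) :
    1 - ε < (prodBernoulli Wt).real (linkIn (↑Qt : Set V) Sd Ft) :=
  hF.lt_real hchain hη hB₀ hsrc hTn (Skel.real_biUnion_openConn_routeW_le_linkIn G Wt hSQ hSF hoS)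

/-- **THE CHAIN PROPERTY (ADDITIVE SHAPE) APPLIED TO (S0) CHAIN FACTS**: the facts of length `n + 1` under `W'` on a graph with degrees `≤ Δ′`,
`p < 1`, `δ ∈ (0, 1]`, the additive chain estimate with constant `C` (the shape of `KNLevels.chain_edge_additive_F_KN`, handed in as `hC`), a part
`B₀` of the first level and the last true target inside `Ft` with `P_{W'}(⋃_{t ∈ Ft} o ↔ t) ≤ μA` ⟹ `P_{W'}(⋃_{t ∈ B₀} o ↔ t) − (n+1)(C·δ + η) ≤ μA`
(no source hypothesis, no `η ≤ δ/2`). [cite: KozmaNitzan2024, §4 Lemma 11 (pp. 22–23), Lemma 12 (pp. 23–25)] [this work] -/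
theorem le_real [Countable V] {s : ℕ → TStep G'} {T' : ℕ → Finset V} {n : ℕ} (hF : ChainFactsF W' p Δ' δ η o s T' n)
    (hp1 : (p : ℝ) < 1) (hΔ : ∀ x, G'.degree x ≤ Δ') (hδ : 0 < δ) (hδ1 : δ ≤ 1) {C : ℝ} {B₀ Ft : Finset V} {μA : ℝ}
    (hC : ∀ (n : ℕ) ⦃δ : ℝ⦄, 0 < δ → δ ≤ 1 → ∀ (p : unitInterval), (p : ℝ) < 1 →
      ∀ (G : SimpleGraph V) [G.LocallyFinite], (∀ x, G.degree x ≤ Δ') →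
      ∀ (W : Sym2 V → unitInterval) (s : Fin (n + 1) → TStep G) (T' : Fin (n + 1) → Finset V) (η : ℝ),
      (∀ i : Fin (n + 1), (s i).L.o = (s 0).L.o) →
      (∀ i : Fin n, T' (Fin.castSucc i) ⊆ (s i.succ).L.X 0) →
      (∀ i : Fin (n + 1), T' i ⊆ (s i).T) →
      (∀ i : Fin (n + 1), (s i).KitsAtF W p Δ' δ) →
      (∀ i : Fin (n + 1), (prodBernoulli W).real (⋃ t ∈ (s i).T \ T' i, openConn (s 0).L.o t) ≤ η) →
        (prodBernoulli W).real (s 0).L.reachB - (n + 1 : ℕ) * (C * δ + η) ≤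
          (prodBernoulli W).real (⋃ t ∈ T' (Fin.last n), openConn (s 0).L.o t))
    (hB₀ : B₀ ⊆ (s 0).L.X 0) (hTn : T' n ⊆ Ft) (hdom : (prodBernoulli W').real (⋃ t ∈ Ft, openConn o t) ≤ μA) :
    (prodBernoulli W').real (⋃ t ∈ B₀, openConn o t) - (n + 1 : ℕ) * (C * δ + η) ≤ μA := by
  have hle : ∀ i : Fin (n + 1), (i : ℕ) ≤ n := fun i => Nat.lt_succ_iff.1 i.2
  let sF : Fin (n + 1) → TStep G' := fun i => s i
  let TF : Fin (n + 1) → Finset V := fun i => T' i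
  have ho0 : (sF 0).L.o = o := hF.src ((0 : Fin (n + 1)) : ℕ) (hle 0)
  have ho' : ∀ i : Fin (n + 1), (sF i).L.o = (sF 0).L.o := fun i => by rw [ho0]; exact hF.src i (hle i)
  have hlink : ∀ i : Fin n, TF (Fin.castSucc i) ⊆ (sF i.succ).L.X 0 := fun i => by
    show T' (Fin.castSucc i) ⊆ (s (i.succ : ℕ)).L.X 0
    have e : ((i.succ : Fin (n + 1)) : ℕ) = (Fin.castSucc i : ℕ) + 1 := by simp
    rw [e]
    exact hF.link _ (by have := i.2; simp only [Fin.val_castSucc]; omega)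
  have hexc' : ∀ i : Fin (n + 1), (prodBernoulli W').real (⋃ t ∈ (sF i).T \ TF i, openConn (sF 0).L.o t) ≤ η := fun i => by
    rw [ho0]; exact hF.exc i (hle i)
  have hmain := hC n hδ hδ1 p hp1 G' hΔ W' sF TF η ho' hlink (fun i => hF.sub i (hle i)) (fun i => hF.kits i (hle i)) hexc'
  have hsrc : (prodBernoulli W').real (⋃ t ∈ B₀, openConn o t) ≤ (prodBernoulli W').real (sF 0).L.reachB := by
    refine measureReal_mono (fun ω hω => ?_) (measure_ne_top _ _)
    simp only [Set.mem_iUnion, exists_prop] at hω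
    obtain ⟨t, ht, hωt⟩ := hω
    show ω ∈ ⋃ b ∈ (s ((0 : Fin (n + 1)) : ℕ)).L.X 0, openConn (s ((0 : Fin (n + 1)) : ℕ)).L.o b
    rw [Fin.val_zero, hF.src 0 (Nat.zero_le _)]
    exact Set.mem_biUnion (Finset.mem_coe.2 (hB₀ ht)) hωt
  have hlast : (prodBernoulli W').real (⋃ t ∈ TF (Fin.last n), openConn o t) ≤ μA := by
    refine le_trans (measureReal_mono (fun ω hω => ?_) (measure_ne_top _ _)) hdom
    simp only [Set.mem_iUnion, exists_prop] at hω ⊢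
    obtain ⟨t, ht, hωt⟩ := hω
    refine ⟨t, hTn ?_, hωt⟩
    have e : TF (Fin.last n) = T' n := by show T' ((Fin.last n : Fin (n + 1)) : ℕ) = T' n; rw [Fin.val_last]
    rw [← e]; exact ht
  rw [ho0] at hmain
  linarith

end ChainFactsF

end Skelφ

end Summit.CriticalPhenomena.PercolationContinuityZ3.Theorems.Transplant

end
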